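import Summits.CriticalPhenomena.Ising3DConformalLimit.Theses.SubPtolemyInterlacing
import Literature.Probability.LatticeModels.CriticalUrsellFourSign
import Literature.Probability.LatticeModels.CriticalAxisRatioRegularity
import HarnessLib

/-!
# Line `Sketch` for the crux `SubPtolemyInterlacing.Interlacing` (stmt-CriticalPhenomena-15702) — stub `stub_monotone`

Axial monotonicity of the critical two-point function on `ℤ³` (`u ≥ 1`, i.e. `P₂ ≤ P₁`):
`G(a+b) G(b+c) ≤ G(a) G(c)` (Messager–Miracle-Solé / `criticalTwoPoint_axis_succ_le`, `0 ≤ G ≤ 1`).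

Helper file of the line `Sketch` (lead skeleton `Cruxes/Interlacing/Lines/Sketch.lean`): proves the registered stub
`stub_monotone` verbatim (name + signature). No definitions, no named facts, no sorry.
-/

noncomputable section

namespace Summit.CriticalPhenomena.Ising3DConformalLimit.Cruxes.Interlacing.Sketch

open Filter MeasureTheory
open scoped symmDiff Topology
open Literature.Probability.LatticeModels Literature.Probability.Percolation

/-- The critical axis two-point function `m ↦ ⟨σ₀σ_{m e₀}⟩_{β_c}` on `ℤ³` is nonincreasing in `m`:
the first step is `G(1) ≤ 1 = G(0)`, the later steps are `criticalTwoPoint_axis_succ_le`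
(Messager–Miracle-Solé / log-convexity). -/
private theorem critAxis_antitone :
    Antitone (fun m : ℕ => criticalTwoPoint 3 (Pi.single 0 (m : ℤ))) := by
  refine antitone_nat_of_succ_le fun m => ?_
  cases m with
  | zero =>
    have h1 : criticalTwoPoint 3 (Pi.single (0 : Fin 3) ((0 : ℕ) : ℤ)) = 1 := by
      rw [Nat.cast_zero, Pi.single_zero]
      exact criticalTwoPoint_zero'
    exact (criticalTwoPoint_le_one' _).trans_eq h1.symm
  | succ k => exact criticalTwoPoint_axis_succ_le 0 k

/-- **Stub `stub_monotone`** of the line `Sketch` (crux stmt-CriticalPhenomena-15702): Axial monotonicity of the critical two-point function on `ℤ³` (`u ≥ 1`, i.e. `P₂ ≤ P₁`): `G(a+b) G(b+c) ≤ G(a) G(c)` (Messager–Miracle-Solé / `criticalTwoPoint_axis_succ_le`, `0 ≤ G ≤ 1`). -/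
theorem stub_monotone : ∀ a b c : ℕ,
    criticalTwoPoint 3 (Pi.single 0 ((a + b : ℕ) : ℤ)) * criticalTwoPoint 3 (Pi.single 0 ((b + c : ℕ) : ℤ)) ≤
      criticalTwoPoint 3 (Pi.single 0 ((a : ℕ) : ℤ)) * criticalTwoPoint 3 (Pi.single 0 ((c : ℕ) : ℤ)) := by
  intro a b c
  exact mul_le_mul (critAxis_antitone (Nat.le_add_right a b))
    (critAxis_antitone (Nat.le_add_left c b)) (criticalTwoPoint_nonneg' _)
    (criticalTwoPoint_nonneg' _)

end Summit.CriticalPhenomena.Ising3DConformalLimit.Cruxes.Interlacing.Sketch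

end
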